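import Mathlib.FieldTheory.RatFunc.AsPolynomial
import Literature.AlgebraicGeometry.Frobenioids.GeometricFrobenioids
import HarnessLib

/-!
# Frobenioids I, Example 6.1: the universal closure of the schema `Ex61_units`
# ("`O^×(A) = O^▷(A) = k_L^×`") is REFUTED over the interface `GeometricDivisorData` — PROOF-ONLY

Mochizuki, *The geometry of Frobenioids I: the general theory*, Kyushu J. Math. **62** (2008)
293–400, Example 6.1, kurims p. 110 [cite: MochizukiFrdI2008, Ex. 6.1 p.110]: "`O^×(A) = O^▷(A) = k_L^×`,
where `k_L` denotes the algebraic closure of `k` in `L`" (since `V[L]` is a proper normal variety).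

`GeometricFrobenioids.lean` (abc-iut-L1, v2/v4) types this claim as the SCHEMA `Ex61_units (k := k) Γ`
over the INTERFACE `Γ : GeometricDivisorData K K̃` (free fields `B`, `div`, …), explicitly labelled there
"faithful to print only for THE geometric data of a proper normal variety; not a closed citable fact".
FACT-LIST row F-1102 of the abc-iut cell nevertheless lists it as a bindable named fact. This file
records the kernel event that classifies the row: the universal closure over the interface is FALSE
(`not_forall_ex61_units`). Witness (`exists_not_ex61_units`): over `K = K̃ = k(X)` (the
rational function field `RatFunc k`), take one prime divisor everywhere, `Φ(L) = ℤ_{≥0}`, `B(L) = L^×`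
(ALL units) and `div ≡ 0`; every interface law holds trivially, but for `Spec K ∈ Ob(D)` the unit
`X ∈ B(K) = K^×` has `div(X) = 0` while `X` is transcendental over `k` (`RatFunc.transcendental_X`),
contradicting the clause "`div(f) = 0 ↔ f` algebraic over `k`". So the row is a hypothesis ON DATA
(R5/W2-8 (5): meaningful only at THE geometric instance, which the tree does not construct — proper
normal varieties and Cartier divisors are not in Mathlib); no consumer in the tree binds it. Nothing in
print is contradicted; nothing here concerns [IUTchIII].
-/

namespace Literature.AlgebraicGeometry.Frobenioids

open CategoryTheory

/-- **The witness.** Over `K = K̃ = k(X)` (`RatFunc k`) there are interface data violating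
`Ex61_units`: one prime divisor over every `Spec L`, `Φ(L) = ℤ_{≥0}` (all effective vectors),
`B(L) = L^×` (ALL units), `div ≡ 0`, identity maps of primes, ramification `1` — every law of
`GeometricDivisorData` holds trivially (`Ob(D) ≠ ∅` by `Spec K`, the bottom intermediate field), yet
`X ∈ B(K) = K^×` has `div(X) = 0` while `X` is transcendental over `k` (`RatFunc.transcendental_X`).
These are NOT the geometric data of any proper normal variety (there `Ker(B(L) → Φ(L)^gp) = k_L^×`).
[cite: MochizukiFrdI2008, Ex. 6.1 p.110] -/
theorem exists_not_ex61_units (F : Type) [Field F] :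
    ∃ Γ : GeometricDivisorData (RatFunc F) (RatFunc F), ¬ Ex61_units (k := F) Γ := by
  let Γ : GeometricDivisorData (RatFunc F) (RatFunc F) :=
    { primeDiv := fun _ => Unit
      Phi := fun _ => ⊤
      B := fun _ => ⊤
      div := fun _ => 1
      over := fun _ Q => Q
      ram := fun _ _ => 1
      ram_pos := fun _ _ => one_pos
      over_finite := fun _ _ => Set.toFinite _
      over_surjective := fun _ => fun Q => ⟨Q, rfl⟩
      over_id := fun _ _ => rfl
      ram_id := fun _ _ => rfl
      over_comp := fun _ _ _ => rfl
      ram_comp := fun _ _ _ => rfl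
      pull_mem := fun _ _ _ => trivial
      map_mem := fun _ _ _ => trivial
      div_natural := fun _ _ => by simp
      div_mem_gp := fun X _ =>
        ⟨0, (⊤ : AddSubmonoid (Unit →₀ ℕ)).zero_mem, 0, AddSubmonoid.zero_mem _, by simp⟩
      qCartier := fun _ _ => ⟨1, one_pos, trivial⟩
      sub_mem := fun _ _ _ _ _ _ => trivial
      primeDiv_nonempty := ⟨⟨⊥⟩, ⟨()⟩⟩ }
  refine ⟨Γ, fun h => ?_⟩
  let X₀ : FinSubextCat (RatFunc F) (RatFunc F) := ⟨⊥⟩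
  have hXmem : (RatFunc.X : RatFunc F) ∈ (⊥ : IntermediateField (RatFunc F) (RatFunc F)) :=
    IntermediateField.mem_bot.mpr ⟨RatFunc.X, rfl⟩
  have hX0 : (⟨RatFunc.X, hXmem⟩ : (⊥ : IntermediateField (RatFunc F) (RatFunc F))) ≠ 0 := by
    intro h0
    exact RatFunc.X_ne_zero (congrArg Subtype.val h0)
  let u : (X₀.L)ˣ := Units.mk0 _ hX0
  let f : Γ.B X₀ := ⟨u, trivial⟩
  have hdiv : Γ.div X₀ f = 1 := rfl
  have halg : IsAlgebraic F (RatFunc.X : RatFunc F) := (h X₀ f).1.mp hdiv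
  exact RatFunc.transcendental_X halg

/-- **F-1102: the universal closure of the Example 6.1 schema `Ex61_units` is FALSE** over the interface
`GeometricDivisorData` (witness: `k = ℚ`, `K = K̃ = ℚ(X)`, the degenerate data of
`exists_not_ex61_units`, the unit `X`). The row is a hypothesis on data — faithful to print only at THE geometric instance (not in the
tree); admissible at named instances only. [cite: MochizukiFrdI2008, Ex. 6.1 p.110] -/
theorem not_forall_ex61_units :
    ¬ ∀ (k : Type) [Field k] (K : Type) [Field K] (Kt : Type) [Field Kt] [Algebra K Kt] [Algebra k Kt]
        (Γ : GeometricDivisorData K Kt), Literature.AlgebraicGeometry.Frobenioids.Ex61_units (k := k) Γ :=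
  fun h => by
    obtain ⟨Γ, hΓ⟩ := exists_not_ex61_units ℚ
    exact hΓ (@h ℚ _ (RatFunc ℚ) _ (RatFunc ℚ) _ _ (RatFunc.instAlgebraOfPolynomial ℚ ℚ) Γ)

end Literature.AlgebraicGeometry.Frobenioids
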